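import Literature.IUT.LogThetaLattice.GlobalLGPFrobenioidsRealifiedTransport
import HarnessLib

/-!
# [IUTchIII] Prop. 3.10 (i) «Kummer isomorphisms … compatible with the various … natural isomorphisms» — the
# realification arrow: the Kummer transports of `𝓕⊛` and of its REALIFICATION `𝓕⊛ℝ` COMMUTE with the
# realification functor of [FrdI] Prop. 5.3 (proof-only companion of `GlobalLGPFrobenioidsRealifiedTransport.lean`)

abc-iut cell, layer L6, seat abc-iut-L6-t5 (gen 6). S. Mochizuki, *Inter-universal Teichmüller theory III*,
kurims manuscript (May 2020) `paper:url-4b091feeb646`, §3, Prop. 3.10 (i) p. 148 l. 26–86 ("Kummer isomorphisms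
of fields, monoids, Frobenioids, and `𝓕⊩`-prime-strips … `(^{n,m}𝓕⊛_MOD)_α ⥲ 𝓕⊛_MOD(^{n,∘}𝓗𝓣^𝒟)_α` … that are compatible
with the various equalities, natural inclusions, and natural isomorphisms discussed above"), Prop. 3.7 (v)
p. 112 l. 1–4 ("the products of realification functors `∏ (†𝓕⊛_𝔪𝔬𝔡)_j → ∏ (†𝓕⊛ℝ_𝔪𝔬𝔡)_j` [cf. [FrdI], Proposition
5.3]"), and *II*, Cor. 4.7 (i) p. 141 ("the natural realification functor `𝓕⊛_mod(†𝒟⊚) → 𝓕⊛ℝ_mod(†𝒟⊚)`")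
[claim: Mochizuki2012, status: disputed]; [cite: MochizukiFrdI2008, Prop. 5.3 p.103] for the realification.

PROOF-ONLY (no `def`, nothing assumed). With abc-iut-w4-d002's Kummer transport of the model global Frobenioid
`frakCatTransport σ : 𝓕⊛(K) ⥤ 𝓕⊛(K')` (p413222; the `F^×`-enlargement of `(†𝓕⊛_𝔪𝔬𝔡)_α` over the model places,
`Γ_v = ℝ`), abc-iut-w5-d153's realification quotient `Prop37.toRlf K : 𝓕⊛(K) ⥤ (†𝓕⊛ℝ)(K)` (p414672; `(n, f) ↦
(n, Div f)`, [FrdI] Prop. 5.3) and this seat's realified transport `Prop37.FrakRlfCat.transport σ` (p434125):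
* `frakTransport_prinFamily` — `σ_* Div(f) = Div(σ f)` (principal families are carried to principal families;
  [IUTchIII] Rmk. 3.6.1 across `σ`, abc-iut-w4-d002's `betaModel_placesEquiv`);
* **`frakCatTransport_comp_toRlf`** — the square of functors COMMUTES ON THE NOSE:
  `frakCatTransport σ ⋙ toRlf K' = toRlf K ⋙ FrakRlfCat.transport σ` (the Kummer isomorphism of Frobenioids
  and the Kummer isomorphism of realified Frobenioids are compatible with the realification functor);
* the Kummer-column / log-link forms `kummer_realification_compat`, `logLink_realification_compat` for
  [IUTchIII] Prop. 3.10 (i)/(iii) at the model (`kummerRlf`, `logLinkRlf` of p434125).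
Nothing here asserts a disputed claim or takes a side on [IUTchIII] Cor. 3.12; typed ≠ discharged.
-/

noncomputable section

namespace Literature.IUT.LogThetaLattice

open CategoryTheory NumberField

namespace GlobalFrobenioidModels

variable {K K' : Type} [Field K] [NumberField K] [Field K'] [NumberField K']

/-- **`σ_* Div(f) = Div(σ f)`**: the Kummer transport carries the principal family of `f ∈ K^×` to the principal
family of `σ f ∈ K'^×` ([IUTchIII] Rmk. 3.6.1 across `σ`: `β_{σv}(σ f) = β_v(f)`, abc-iut-w4-d002's
`betaModel_placesEquiv`). ([IUTchIII] Prop 3.10 (i) p.148) [claim: Mochizuki2012, status: disputed] -/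
theorem frakTransport_prinFamily (σ : K ≃+* K') (f : Kˣ) :
    frakTransport σ (Prop37.prinFamily K f) = Prop37.prinFamily K' (Units.map (σ : K →* K') f) := by
  refine FrakObj.ext_cls (funext fun v' => ?_)
  obtain ⟨v, rfl⟩ := (placesEquiv σ).surjective v'
  rw [cls_frakTransport_placesEquiv, Prop37.prinFamily, Prop37.prinFamily, cls_betaDiv, cls_betaDiv,
    betaModel_placesEquiv]

end GlobalFrobenioidModels

namespace Prop37

namespace FrakRlfCat

open GlobalFrobenioidModels

variable {K K' : Type} [Field K] [NumberField K] [Field K'] [NumberField K']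

/-- The realification functor after the Kummer transport of `𝓕⊛`, on rational functions: `Div(σ f)`.
([IUTchIII] Prop 3.10 (i) p.148) [claim: Mochizuki2012, status: disputed] -/
theorem fn_toRlf_map_frakCatTransport_map (σ : K ≃+* K')
    {X Y : FrakCat K (ModelPlaces K) (fun _ => ℝ) nonnegModel betaModel} (φ : X ⟶ Y) :
    FrakRlfCat.fn ((toRlf K').map ((frakCatTransport σ).map φ)) =
      frakTransport σ (FrakRlfCat.fn ((toRlf K).map φ)) := by
  rw [fn_toRlf_map, fn_frakCatTransport_map, fn_toRlf_map, frakTransport_prinFamily]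

/-- **The Kummer isomorphisms of `𝓕⊛` and of its realification `𝓕⊛ℝ` are COMPATIBLE WITH THE REALIFICATION
FUNCTOR** ([FrdI] Prop. 5.3; [IUTchII] Cor. 4.7 (i) "natural realification functor"; [IUTchIII] Prop. 3.7 (v),
Prop. 3.10 (i) "compatible with the various … natural isomorphisms"): the square of functors
`𝓕⊛(K) ⥤ 𝓕⊛(K') ⥤ 𝓕⊛ℝ(K')` = `𝓕⊛(K) ⥤ 𝓕⊛ℝ(K) ⥤ 𝓕⊛ℝ(K')` commutes ON THE NOSE (an equality of functors).
([IUTchIII] Prop 3.10 (i) p.148) [claim: Mochizuki2012, status: disputed] -/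
theorem frakCatTransport_comp_toRlf (σ : K ≃+* K') :
    frakCatTransport σ ⋙ toRlf K' = toRlf K ⋙ transport σ := by
  refine CategoryTheory.Functor.ext (fun X => rfl) (fun X Y φ => ?_)
  apply FrakRlfCat.hom_ext
  · simp [deg_eqToHom]
  · simp [fn_eqToHom, deg_eqToHom, frakTransport_prinFamily, -frakTransport_apply]

/-- On objects the two routes agree definitionally (`σ_* α` either way). ([IUTchIII] Prop 3.10 (i) p.148)
[claim: Mochizuki2012, status: disputed] -/
theorem toRlf_obj_frakCatTransport_obj (σ : K ≃+* K')
    (X : FrakCat K (ModelPlaces K) (fun _ => ℝ) nonnegModel betaModel) :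
    (toRlf K').obj ((frakCatTransport σ).obj X) = (transport σ).obj ((toRlf K).obj X) := rfl

section KummerColumn

variable {Kf : ℤ → Type} [∀ m, Field (Kf m)] [∀ m, NumberField (Kf m)] {Kc : Type} [Field Kc] [NumberField Kc]

/-- **[IUTchIII] Prop. 3.10 (i) at the model — the Kummer isomorphism of Frobenioids `(^{n,m}𝓕⊛)_α ⥲ 𝓕⊛(^{n,∘})_α`
(abc-iut-w4-d002's `frakCatTransport (κ m)`) and of realified Frobenioids `(^{n,m}𝓕⊛ℝ)_α ⥲ 𝓕⊛ℝ(^{n,∘})_α`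
(`kummerRlf κ m`) are compatible with the realification functors** at `(n,m)` and `(n,∘)`.
([IUTchIII] Prop 3.10 (i) p.148) [claim: Mochizuki2012, status: disputed] -/
theorem kummer_realification_compat (κ : ∀ m, Kf m ≃+* Kc) (m : ℤ) :
    frakCatTransport (κ m) ⋙ toRlf Kc = toRlf (Kf m) ⋙ (kummerRlf κ m).functor :=
  frakCatTransport_comp_toRlf (κ m)

omit [NumberField Kc] in
/-- … and so are the log-link-induced functors `(^{n,m}𝓕⊛) ⥤ (^{n,m+1}𝓕⊛)` / `(^{n,m}𝓕⊛ℝ) ⥤ (^{n,m+1}𝓕⊛ℝ)` (transport along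
the log-Kummer field identification `κ_{m+1}⁻¹ ∘ κ_m`; [IUTchIII] Prop. 3.10 (iii)). ([IUTchIII] Prop 3.10 (iii) p.149)
[claim: Mochizuki2012, status: disputed] -/
theorem logLink_realification_compat (κ : ∀ m, Kf m ≃+* Kc) (m : ℤ) :
    frakCatTransport ((κ m).trans (κ (m + 1)).symm) ⋙ toRlf (Kf (m + 1)) = toRlf (Kf m) ⋙ logLinkRlf κ m :=
  frakCatTransport_comp_toRlf _

end KummerColumn

end FrakRlfCat

end Prop37

end Literature.IUT.LogThetaLattice
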